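import Summits.BirchSwinnertonDyer.Rank1Residual.X11b.KolyvaginShaOrderByName
import HarnessLib

/-!
# Kolyvagin's ORDER bound at ONE odd surjective prime in the `M₀`-currency (`p^{M₀} x₀ = y_K ∉ p^{M₀+1}E(K)`),
# K-side and ℚ-side, with the duality inputs BY NAME (`casselsTate_levelInputs K`,
# `exists_weilPairing_holds`) — companion of `X11b/KolyvaginShaOrderByName.lean` (INDEX currency)

Cell `b2b-bsdres`, team x11b3 (N8/O2 = X11b @ 3); seat x11b3-p2 GEN 55 (unit claimed D-0075 →
BSD:K2/P4 «Kolyvagin-in-kernel»). Summit-side THEOREM-ONLY file (no definition, no named fact,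
no `sorry`); `K : Type`; a general odd prime `p`. LINE (D-0145): the same declared support items as
the companion file (stmt-BirchSwinnertonDyer-19411 `ClassicalInputsThree` ∕ `PublishedInputsKolyThree`,
shared item 20191 `ShimuraCasselsTateLevelInputs` = `∀ K, casselsTate_levelInputs K`).

HONEST FRAMING (cell `b2b-bsdres`, run/shared/lean/b2b/bsd-rank1-residual/, verbatim in every
file): the goal of the cell is to DELETE the COMBINATION-SHAPED residual classes of the
Birch–Swinnerton-Dyer formula for ALL analytic-rank `≤ 1` elliptic curves over `ℚ` — "full BSD
formula for every rank `≤ 1` curve in class `C`" assembled STRICTLY from published theorems — so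
that the rank-`≤ 1` remainder becomes exactly the CONSTRUCTION-SHAPED classes, which are TYPED
(missing-input `Prop`s), NOT attempted.  This is not "finishing BSD".  Nothing here is booked; no
mark / label / count / tier moves; X11b @ `p` stays OPEN / CONSTRUCTION-SHAPED.

WHAT THIS FILE DOES.  The companion file gives McCallum's §1 Theorem (Kolyvagin) BY NAME in the
Heegner-INDEX currency (`M₀ = ord_p [E(K) : ℤ y_K]`, finite index displayed or supplied by
`kolyvagin`).  The tree's K2 consumers that carry a DIVISIBILITY certificate instead of the index —
`p^{M₀} x₀ = y_K`, `y_K ∉ p^{M₀+1} E(K)`, `M₀ ≥ 1` (the `M₀`-form ENDs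
`card_sha_primary_le_at_of_gross1991E0_of_localDuality_of_prop37` ∕
`card_sha_rat_primary_le_of_gross1991E0_of_localDuality_of_prop37`, x11b3 GEN 54) — get here the same
two ENDs with EVERY displayed duality binder (`c`, `e`, `hμ`, `hadd₁`, `hadd₂`, `hgal`, `halt`,
`hnondeg`, `inv`, `hPT'`, `hinv`, `hH3`, `hB`, `hPτ`) REPLACED by the named fact
`casselsTate_levelInputs K` (+ the tree theorems `exists_weilPairing_holds`,
`exists_conj_of_isImaginaryQuadratic`): no finite-index hypothesis, no rank input.  CONDITIONAL on
EXACTLY the three named facts {`Gross1991_heegnerPoint_sub_ratTorsion_mem_E0`,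
`GrossLMS1991.prop37_2_reductionCongruence N W K p`, `casselsTate_levelInputs K`} (PUBLISHED, NOT
discharged) + `hN`; nothing booked; no census number moves (T7).

References: [cite: McCallumLMS1991, §1 Theorem (Kolyvagin), Thm. 5.4, Cor. 5.6]
[cite: GrossLMS1991, Thm. 2.2 (2), §3 Prop. 3.7 (2), §6 Prop. 6.2 (1)]
[cite: MilneADT2006, Ch. I §6, Prop. 6.9, Thm. 6.13(a)] [cite: SilvermanAEC2009, Prop. III.8.1]
[cite: SerreGaloisCohomology1997, I.§2.4]

presearch: `rg _of_casselsTateLevelInputs Summits/BirchSwinnertonDyer/Rank1Residual/X11b/` → only the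
companion file (INDEX currency); nothing minted.
-/

noncomputable section

namespace Summit.BirchSwinnertonDyer.Rank1Residual.X11b.KolyvaginDischarged

open scoped Classical
open WeierstrassCurve Field NumberField IsDedekindDomain Function
open Literature.NumberTheory.EllipticCurves Literature.NumberTheory.GaloisRepresentations
open Literature.NumberTheory.EllipticCurves.ModularForms
open Literature.NumberTheory.GaloisCohomology
open Literature.NumberTheory.EllipticCurves.GrossLMS1991 (prop37_2_reductionCongruence)
open Summit.BirchSwinnertonDyer.Rank1Residual.X11b.KolyvaginAssembly

variable {K : Type} [Field K] [NumberField K] {N : ℕ} {W : WeierstrassCurve ℚ}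

/-- **McCallum 1991 §1 Theorem (Kolyvagin) at ONE odd surjective prime `p`, `M₀`-currency, K-side, with
the duality inputs BY NAME:** for `p^{M₀} x₀ = y_K ∉ p^{M₀+1} E(K)`, `M₀ ≥ 1` (`E = W/ℚ` globally
minimal without CM, `N = N_E`, `K` imaginary quadratic Heegner with `d_K ∉ {−3, −4}`, `y_K` a
non-torsion Heegner point, `ρ̄_{E,p}` onto): `Ш(E/K)[p^∞]` finite ∧ killed by `p^{M₀}` ∧
`#Ш(E/K)[p^∞] ≤ p^{2M₀}` ∧ `ord_p # ≤ 2M₀`.  The complex conjugation, the Weil pairing on `E[p^{2M₀}]`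
(`exists_weilPairing_holds`) and `casselsTate_levelInputs K` feed every displayed binder of
`card_sha_primary_le_at_of_gross1991E0_of_localDuality_of_prop37`.  CONDITIONAL on EXACTLY the three
named facts (PUBLISHED, NOT discharged) + `hN`; nothing booked; no mark / count / tier moves.
[cite: McCallumLMS1991, §1 Theorem (Kolyvagin), Cor. 5.6] [cite: GrossLMS1991, §3 Prop. 3.7 (2), §6 Prop. 6.2 (1)]
[cite: MilneADT2006, Ch. I §6, Thm. 6.13(a)] [cite: SilvermanAEC2009, Prop. III.8.1] -/
theorem card_sha_primary_le_at_of_gross1991E0_of_prop37_of_casselsTateLevelInputs [NeZero N]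
    [W.IsGloballyMinimal] {p : ℕ} (hp : p.Prime) (hp2 : p ≠ 2)
    (hN : ∀ [W.IsElliptic], N = W.conductorNorm ℤ)
    (hE0 : Gross1991_heegnerPoint_sub_ratTorsion_mem_E0)
    (hγ : prop37_2_reductionCongruence N W K p) (hCT : casselsTate_levelInputs K) :
    ∀ [W.IsElliptic] (_hE : ¬ W.HasCM) (_hK : IsImaginaryQuadratic K)
      (_hD : NumberField.discr K ≠ -3 ∧ NumberField.discr K ≠ -4)
      (_hH : SatisfiesHeegnerHypothesis N K)
      {P : (W.baseChange K).toAffine.Point} (_hP : IsHeegnerPoint N W K P)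
      (_hnt : ¬ IsOfFinAddOrder P) (_hρ : W.HasSurjectiveModNGaloisRep p)
      {M₀ : ℕ} (_hM₀ : 1 ≤ M₀) {x₀ : (W.baseChange K).toAffine.Point} (_hx₀ : p ^ M₀ • x₀ = P)
      (_hmax : ∀ Q : (W.baseChange K).toAffine.Point, p ^ (M₀ + 1) • Q ≠ P),
      Finite (AddCommGroup.primaryComponent (W.baseChange K).sha p) ∧
      (∀ c ∈ AddCommGroup.primaryComponent (W.baseChange K).sha p, p ^ M₀ • c = 0) ∧
      Nat.card (AddCommGroup.primaryComponent (W.baseChange K).sha p) ≤ p ^ (2 * M₀) ∧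
      padicValNat p (Nat.card (AddCommGroup.primaryComponent (W.baseChange K).sha p)) ≤ 2 * M₀ := by
  intro _ hE hK hD hH P hP hnt hρ M₀ hM₀ x₀ hx₀ hmax
  haveI : (W.baseChange K).IsElliptic := inferInstanceAs (W.map (algebraMap ℚ K)).IsElliptic
  haveI : NeZero (p ^ M₀) := ⟨pow_ne_zero _ hp.ne_zero⟩
  obtain ⟨c, hc, hcc⟩ := exists_conj_of_isImaginaryQuadratic (K := K) hK
  have h2 : 2 ≤ p ^ M₀ * p ^ M₀ :=
    le_trans (le_trans hp.two_le (Nat.le_self_pow (by omega) p))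
      (Nat.le_mul_of_pos_right _ (NeZero.pos (p ^ M₀)))
  have hq : ((p ^ M₀ * p ^ M₀ : ℕ) : K) ≠ 0 :=
    Nat.cast_ne_zero.mpr (mul_ne_zero (NeZero.ne (p ^ M₀)) (NeZero.ne (p ^ M₀)))
  obtain ⟨e, hμ, hadd₁, hadd₂, halt, hnd, hgal⟩ :=
    exists_weilPairing_holds (W.baseChange K) (p ^ M₀ * p ^ M₀) h2 hq
  obtain ⟨inv, hPT', hH3, hperf, hB, hPτ⟩ :=
    hCT W p M₀ hp hp2 hM₀ c hc hcc e hμ hadd₁ hadd₂ hgal halt hnd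
  exact card_sha_primary_le_at_of_gross1991E0_of_localDuality_of_prop37 hp hp2 hN hE0 hγ hE hK hD hH hP
    hnt hρ hM₀ hc hcc hx₀ hmax e hμ hadd₁ hadd₂ hgal halt hnd inv hPT' (fun v ↦ (hperf v).1.injective)
    hH3 hB hPτ

/-- **The same over `ℚ`** (descent by the fact-free `sha_primary_order_of_baseChange_of_coprime`, `p`
odd prime to `[K : ℚ] = 2`): for `p^{M₀} x₀ = y_K ∉ p^{M₀+1} E(K)`, `M₀ ≥ 1`: `Ш(E/ℚ)[p^∞]` finite ∧
killed by `p^{M₀}` ∧ `#Ш(E/ℚ)[p^∞] ≤ p^{2M₀}` ∧ `ord_p # ≤ 2M₀`, with the duality inputs BY NAME.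
CONDITIONAL on EXACTLY the three named facts {`Gross1991_heegnerPoint_sub_ratTorsion_mem_E0`,
`prop37_2_reductionCongruence N W K p`, `casselsTate_levelInputs K`} + `hN`; nothing booked; no mark /
count / tier moves. [cite: McCallumLMS1991, §1 Theorem (Kolyvagin), Cor. 5.6]
[cite: GrossLMS1991, Thm. 2.2 (2), §3 Prop. 3.7 (2), §6 Prop. 6.2 (1)] [cite: SerreGaloisCohomology1997, I.§2.4] -/
theorem card_sha_rat_primary_le_of_gross1991E0_of_prop37_of_casselsTateLevelInputs [NeZero N]
    [W.IsGloballyMinimal] {p : ℕ} (hp : p.Prime) (hp2 : p ≠ 2)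
    (hN : ∀ [W.IsElliptic], N = W.conductorNorm ℤ)
    (hE0 : Gross1991_heegnerPoint_sub_ratTorsion_mem_E0)
    (hγ : prop37_2_reductionCongruence N W K p) (hCT : casselsTate_levelInputs K) :
    ∀ [W.IsElliptic] (_hE : ¬ W.HasCM) (_hK : IsImaginaryQuadratic K)
      (_hD : NumberField.discr K ≠ -3 ∧ NumberField.discr K ≠ -4)
      (_hH : SatisfiesHeegnerHypothesis N K)
      {P : (W.baseChange K).toAffine.Point} (_hP : IsHeegnerPoint N W K P)
      (_hnt : ¬ IsOfFinAddOrder P) (_hρ : W.HasSurjectiveModNGaloisRep p)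
      {M₀ : ℕ} (_hM₀ : 1 ≤ M₀) {x₀ : (W.baseChange K).toAffine.Point} (_hx₀ : p ^ M₀ • x₀ = P)
      (_hmax : ∀ Q : (W.baseChange K).toAffine.Point, p ^ (M₀ + 1) • Q ≠ P),
      Finite (AddCommGroup.primaryComponent W.sha p) ∧
      (∀ c ∈ AddCommGroup.primaryComponent W.sha p, p ^ M₀ • c = 0) ∧
      Nat.card (AddCommGroup.primaryComponent W.sha p) ≤ p ^ (2 * M₀) ∧
      padicValNat p (Nat.card (AddCommGroup.primaryComponent W.sha p)) ≤ 2 * M₀ := by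
  intro _ hE hK hD hH P hP hnt hρ M₀ hM₀ x₀ hx₀ hmax
  haveI : Algebra.IsQuadraticExtension ℚ K := ⟨hK.1⟩
  have hcop : p.Coprime (Module.finrank ℚ K) := by
    rw [hK.1]; exact (Nat.coprime_primes hp Nat.prime_two).mpr hp2
  exact sha_primary_order_of_baseChange_of_coprime W K hp hcop
    (card_sha_primary_le_at_of_gross1991E0_of_prop37_of_casselsTateLevelInputs hp hp2 hN hE0 hγ hCT hE hK
      hD hH hP hnt hρ hM₀ hx₀ hmax)

end Summit.BirchSwinnertonDyer.Rank1Residual.X11b.KolyvaginDischarged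

end
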